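import Mathlib
import HarnessLib
import Summits.NavierStokesRegularity.NavierStokesRegularity.Theorems.LocalTraceTubeDoorIsobaricWindow
import Summits.NavierStokesRegularity.NavierStokesRegularity.Theorems.LocalPressureProfileDoorLocalPointZoomSimilarityPressure

/-!
# The one-window door family — the ISOBARIC-WINDOW DOOR, unconditional form

Cell ns-regularity-ideate, seat p6 (route-directed support for nsreg-p1's door family; bears_on LADDER-NS N0; anchor
`--supports stmt-NavierStokesRegularity-20018`).  The composition left open in `…LocalTraceTubeDoorIsobaricWindow`:
`targetIso_of_zoom` applied to the tree theorem `…LocalPressureProfileDoorLocalPointZoomSimilarityPressure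
.LocalPointZoomSimilarityPressure_proof` (K1 of the pressure door S17⁺; that module imports the route file
`…Theses.LocalPressureProfileDoor`, hence this two-line file is kept separate from the cone-free profile crux).

**`targetIso`**: for a classical Leray–Hopf flow from rapidly decaying data with the local SPACE–TIME Type-I bound
`‖u(t,x)‖ (‖x − x₀‖ + √(ν(T−t))) ≤ M` near `(x₀, T)`, if on ONE nonempty open similarity window `U` the scale-normalised
Riesz pressure becomes isobaric — `(T−t)·(Q[u(t)](x₀ + √(T−t)z) − Q[u(t)](x₀ + √(T−t)z')) → 0` as `t → T⁻` for all
`z, z' ∈ U` — then `u` is backward bounded at `x₀` («Type-I blow-up keeps a pressure gradient on every similarity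
window»).

WHAT THIS IS NOT: not a claim about Navier–Stokes regularity (Clay A) — a local regularity CRITERION conditional on
local space–time Type I; establishment in the cell's sense still requires the cross-family referee PASS + independent
reproduction.
-/

noncomputable section

-- the summit and its single sub-problem share the name (CONVENTIONS §1), as in every Theorems file
set_option linter.dupNamespace false

namespace Summit.NavierStokesRegularity.NavierStokesRegularity.Theorems.LocalTraceTubeDoorIsobaricWindowTarget

open Summit.NavierStokesRegularity.NavierStokesRegularity.Theorems.LocalTraceTubeDoorIsobaricWindow
open Summit.NavierStokesRegularity.NavierStokesRegularity.Theorems.LocalPressureProfileDoorLocalPointZoomSimilarityPressure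

/-- **THE ISOBARIC-WINDOW DOOR (unconditional).**  See the module docstring. -/
theorem targetIso :
    ∀ (ν T : ℝ), 0 < ν → 0 < T → ∀ (u : ℝ → EuclideanSpace ℝ (Fin 3) → EuclideanSpace ℝ (Fin 3))
      (p : ℝ → EuclideanSpace ℝ (Fin 3) → ℝ),
    Literature.Analysis.FluidPDE.IsClassicalNSSolutionOn (Set.Ico 0 T) ν 0 u p →
    Literature.Analysis.FluidPDE.IsLerayHopfOn T ν 0 (u 0) u →
    Literature.Analysis.FluidPDE.HasRapidSpatialDecay (u 0) →
    ∀ (x₀ : EuclideanSpace ℝ (Fin 3)) (ρ M : ℝ), 0 < ρ →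
    (∀ t ∈ Set.Ico 0 T, T - ρ ^ 2 < t → ∀ x ∈ Metric.ball x₀ ρ,
      ‖u t x‖ * (‖x - x₀‖ + Real.sqrt (ν * (T - t))) ≤ M) →
    ∀ (U : Set (EuclideanSpace ℝ (Fin 3))), IsOpen U → U.Nonempty →
    (∀ z ∈ U, ∀ z' ∈ U, Filter.Tendsto (fun t => (T - t) *
        (Literature.Analysis.FluidPDE.pressurePotential (u t) (x₀ + Real.sqrt (T - t) • z) -
          Literature.Analysis.FluidPDE.pressurePotential (u t) (x₀ + Real.sqrt (T - t) • z')))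
      (nhdsWithin T (Set.Iio T)) (nhds 0)) →
    Literature.Analysis.FluidPDE.IsBackwardBoundedAt u T x₀ :=
  targetIso_of_zoom LocalPointZoomSimilarityPressure_proof

end Summit.NavierStokesRegularity.NavierStokesRegularity.Theorems.LocalTraceTubeDoorIsobaricWindowTarget

end
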